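/-
Copyright (c) 2026 the pub-hodgecm-mathlib formalisation cell (harness21).  Prover seat hodgecm-mathlib-K2E1-p14 (g0), Track B «K2-LIT» ENGINE E1, h413 =
`stmt-HodgeConjecture-24833`, route `HCCMUnconditional`, campaign «5Res» (c) «MS-2(χ,τ)» FILE 1 = SHEET (93)(b) row 14 of K2-defs1 (g6), dealt by K2E1-plan (g6) (114)
2026-09-04T11:01:34Z; REPORT-FIRST R1 (census + «(c) = 2 files» + heads) on the K2 bus 11:22:53Z.
-/
import Summits.HodgeConjecture.HodgeConjecture.Theorems.K2E1ChiSectionBridgeU2          -- ★ p859576 row 1 (this seat): `IsChiSection.borel_mul_diagUnit`, `IsChiSection.borelLaw_flatSectionU`; brings the ★ DEFS LEAF p859441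
import Summits.HodgeConjecture.HodgeConjecture.Theorems.K2E1ChiIntertwinedSectionU2      -- ★ p859530 row 3 (K2-defs1): `isChiSection_intertwinedCoeff_two` (`M(z,χ)φ` is a `χʷ`-section)
import Summits.HodgeConjecture.HodgeConjecture.Theorems.K2E1MaassSelbergCMTwoFinalPair     -- ★ p858214 «CM-FINAL-2» ED. 2: `maassSelberg_flatSectionU_cm_two_final′` (survivors `hdec′`, `hΞ₁…hΞ₄`)
import Literature.NumberTheory.Automorphic.NormGroupClosedProofs                         -- ★ `smul_posRealIdele` (`Aut(L∕L⁺)` fixes the positive real ideles)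
import HarnessLib

/-!
# h413 ∕ Track B «K2-LIT», 5Res (c) «MS-2(χ,τ)» FILE 1 — `K2E1ChiMaassSelbergCMTwo`: the Maass–Selberg relation of `U(1,1)` over a CM field for `χ`-SECTIONS — the four
# `K_U`-average densities are `(Hecke-character pair) × (pairing on the section space)`, discharged; survivor `hdec′` only

Cell `pub/hodgecm-mathlib`, crux H413 = `stmt-HodgeConjecture-24833`.  THEOREMS ONLY (no `def`, no `instance`, no `notation`, no named-fact hypothesis, no `sorry`); lane
`--kind proof --supports stmt-HodgeConjecture-24833 --as helper` (count-neutral).  §1–§3 generic `F E c` (`N` generic in §1–§2), §4 the CM pair `(L⁺, L, conj)` at `N = 2`.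

THE MATHEMATICS ([MoeglinWaldspurger1995, II.1.7, IV.2.3]; [Arthur1980TraceFormulaII, §4]; [Garrett2018, §11.3]; [GelbartRogawski1991, §3.1]).  The ★ Maass–Selberg relation of `U(J₂)` at
the CM pair, «CM-FINAL-2» ED. 2 `maassSelberg_flatSectionU_cm_two_final′`, is typed for GENERIC continuous bounded left-`N(𝔸)`∕`B(L⁺)`-invariant coefficients `φ, φ′` of the flat
sections `f_z = φH^z`, `f′_{z′} = φ′H^{z′}` on the sub-tube `1 < Re z′ < Re z`; its only section-specific inputs are the four `K_U`-AVERAGE DATA `hΞᵢ`: idele functions `Ξ₁…Ξ₄`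
(measurable, bounded, `Lˣ`- and `ρ(ℝ_{>0})`-invariant) with `∫_{K_U} α(t k)·conj β(t k) dμ_K = Ξ(t₀₀)` along the torus, for the pairs `(α, β) = (φ, φ′), (φ, φ̃′), (φ̃, φ′), (φ̃, φ̃′)`,
`φ̃ := (∫_{N(𝔸)} f_z(w₀ v ·) dν)·H^{z−1}` the intertwined coefficient.  For `χ`-SECTIONS (★ DEFS LEAF `IsChiSection`: `φ(b g) = χ(b₀₀)φ(g)`) these data are EXPLICIT: if `α` is a
`χ_α`-section and `β` a `χ_β`-section then `α(t k)·conj β(t k) = χ_α(t₀₀)·conj χ_β(t₀₀)·α(k)·conj β(k)` (§1), so **`Ξ(x) = χ_α(x)·conj χ_β(x) · ⟨α, β⟩_K`, `⟨α, β⟩_K := ∫_{K_U} α(k)·conj β(k) dμ_K`**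
— the PAIRING on the (finite-dimensional, row 9 ★ `chiSectionSpace`) section space that replaces the spherical `m·φ₀·conj φ₀′` ∕ `|c(z)|²` of ★ (R6k)₂ `K2E1MaassSelbergSphericalBracketsCMTwo`;
here `φ` is a `χ₁`-section, `φ′` a `χ₂`-section, and `φ̃`, `φ̃′` are `χ₁ʷ`-, `χ₂ʷ`-sections by row 3 ★ `isChiSection_intertwinedCoeff_two` (`χʷ = reflectChar c χ`).  The density
`x ↦ χ_α(x)conj χ_β(x)·P` is measurable (Hecke characters are continuous), bounded by `|P|` for UNITARY characters (★ `IsUnitary.reflectChar`), `Lˣ`-invariant (★ `map_principal`), and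
`ρ(ℝ_{>0})`-invariant under the NORMALISATION `χᵢ(ρ(r)) = 1` («χ trivial on the split component», the census' convention; inherited by `χʷ` because `Aut(L∕L⁺)` fixes `ρ(r)`, ★
`smul_posRealIdele`) — §2.  HEAD (§4) **`maassSelberg_chiSection_cm_two`**: for unitary, `ρ`-normalised `χ₁, χ₂` and continuous bounded `χ₁`-∕`χ₂`-sections `φ, φ′`,
`⟨Λ^T E(f_z), Λ^T E(f′_{z′})⟩_X = c_μ·K·( T^{s₁}∕s₁·[χ₁χ̄₂·⟨φ,φ′⟩_K] + T^{s₂}∕s₂·[χ₁conj χ₂ʷ·⟨φ,φ̃′⟩_K] − T^{−s₂}∕s₂·[χ₁ʷχ̄₂·⟨φ̃,φ′⟩_K] − T^{−s₁}∕s₁·[χ₁ʷconj χ₂ʷ·⟨φ̃,φ̃′⟩_K] )`, `s₁ = z + z̄′ − 1`,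
`s₂ = z − z̄′`, `[Ξ] = ∫_{𝓕_I ∩ {‖x‖≤1}} ‖x‖·Ξ(x) dν_I` — ★ ED. 2 with `hφN hφB hφ′N hφ′B` (§3 adapters over ★ `IsChiSection.unipotent_mul`∕`.toAdelic_mul`) and ALL FOUR `hΞᵢ` DISCHARGED; SURVIVOR `hdec′`
ONLY (the decay of `E(f′_{z′}) − E(f′_{z′})_B` on `{H > T}`, paid for finite-level `K_∞`-finite `φ′` by ★ R6d₂ B′ from `hf′` = row 1 `hφ′.borelLaw_flatSectionU z′`, `hφ′U`, `hφ′arch`).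
COROLLARY **`maassSelberg_chiSection_cm_two_self`** (`χ₁ = χ₂ = χ`): the outer densities are the CONSTANTS `⟨φ,φ′⟩_K`, `⟨φ̃,φ̃′⟩_K` (`χ·χ̄ = 1 = χʷ·conj χʷ`), brackets `κ·⟨·,·⟩_K` with
`κ = ∫_{𝓕_I∩{‖x‖≤1}} ‖x‖ dν_I` (★ `idelicBracket_pos`); the cross densities carry the idele class character `χ·(χ ∘ c)` (they vanish unless `χʷ = χ` — character orthogonality on `C_L^1`,
FILE 2's input, not claimed here).
HONEST LABEL: HC_CM is proved only modulo the 7 printed citations (2 remaining named inputs: hLiu418 = `stmt-HodgeConjecture-24832`, h413 = `stmt-HodgeConjecture-24833`) until rung 0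
closes; count-neutral helper, proves no printed statement, closes no socket; `[ν_G.IsInvInvariant]` and the automorphic measure `μ` stay binders exactly as in ★ ED. 2.

## References
* [MoeglinWaldspurger1995] C. Mœglin, J.-L. Waldspurger, *Spectral decomposition and Eisenstein series* (1995), II.1.7 (`M(w,π)`, cuspidal data `χ`), IV.2.3 (Maass–Selberg relations).
* [Arthur1980TraceFormulaII] J. Arthur, *A trace formula for reductive groups II*, Compositio Math. 40 (1980), §4 (inner product of truncated Eisenstein series).
* [Garrett2018] P. Garrett, *Modern Analysis of Automorphic Forms by Example* 1 (2018), §11.3 (Maass–Selberg relations, rank one).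
* [GelbartRogawski1991] S. Gelbart, J. Rogawski, *L-functions and Fourier–Jacobi coefficients for the unitary group U(3)*, Invent. Math. 105 (1991), §3.1 (`I(χ)` on `U(1,1)`).
-/

set_option autoImplicit false
-- the mandated namespace repeats the single-problem summit's segment (`HodgeConjecture.HodgeConjecture`)
set_option linter.dupNamespace false

noncomputable section

open MeasureTheory Measure NumberField IsDedekindDomain Set MulAction Matrix
open scoped ENNReal NNReal ComplexConjugate MatrixGroups
open Literature.MeasureTheory.Group Literature.NumberTheory
open Literature.NumberTheory.Automorphic Literature.NumberTheory.Automorphic.UnitaryGroup Literature.NumberTheory.GaloisRepresentations AdelicGroupData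
open Summit.HodgeConjecture.HodgeConjecture.Cruxes.H413.K2E1BorelEisensteinU
open Summit.HodgeConjecture.HodgeConjecture.Cruxes.H413.K2E1CharacterEisensteinU2Defs
open Summit.HodgeConjecture.HodgeConjecture.Cruxes.H413.K2E1ChiSectionBridgeU2
open Summit.HodgeConjecture.HodgeConjecture.Cruxes.H413.K2E1ChiIntertwinedSectionU2 (isChiSection_intertwinedCoeff_two)
open Summit.HodgeConjecture.HodgeConjecture.Cruxes.H413.K2E1BorelCosetsDictionary (forall_arithmeticBorel_iff)
open Summit.HodgeConjecture.HodgeConjecture.Cruxes.H413.K2E1MaassSelbergCMTwoFinalPair (maassSelberg_flatSectionU_cm_two_final')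

namespace Summit.HodgeConjecture.HodgeConjecture.Cruxes.H413.K2E1ChiMaassSelbergCMTwo

/-! ## §1 The `K_U`-average of a pair of `χ`-sections along the torus (generic `F E c N`) -/

section Generic

variable {F E : Type} [Field F] [NumberField F] [Field E] [NumberField E] [Algebra F E] {c : E ≃ₐ[F] E} {N : ℕ} [NeZero N]
variable [MeasurableSpace (quasiSplit F E c N).Adelic]

/-- **`∫_{K_U} α(t k)·conj β(t k) dμ_K = χ_α(t₀₀)·conj χ_β(t₀₀) · ⟨α, β⟩_K`** for a `χ_α`-section `α`, a `χ_β`-section `β` and `t ∈ T(𝔸_F)` (`α(t k) = χ_α(t₀₀)α(k)`, ★ DEFS LEAF;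
`t₀₀ = diagUnit _ 0`, the currency of the ★ `hΞᵢ` binders): the `K_U`-average datum of the ★ Maass–Selberg layer for ANY pair of `χ`-sections, any measure `μ_K` on `K_U`.
[cite: MoeglinWaldspurger1995, II.1.7, IV.2.3] -/
theorem integral_chiSection_mul_conj_chiSection_torus_mul
    (μK : Measure ((standardMaximalCompactGL N E).comap (adelicVal F E c N ((StdForm.antidiagonal N).over E)) : Subgroup (quasiSplit F E c N).Adelic))
    {χ₁ χ₂ : HeckeCharacter E} {φ ψ : (quasiSplit F E c N).Adelic → ℂ} (hφ : IsChiSection χ₁ φ) (hψ : IsChiSection χ₂ ψ) (t : ↥(torusInBorel F E c N)) :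
    ∫ k, φ (((t : borelAdelic F E c N) : (quasiSplit F E c N).Adelic) * (k : (quasiSplit F E c N).Adelic)) *
        conj (ψ (((t : borelAdelic F E c N) : (quasiSplit F E c N).Adelic) * (k : (quasiSplit F E c N).Adelic))) ∂μK =
      ((χ₁ (diagUnit (t : borelAdelic F E c N).2 0) : ℂˣ) : ℂ) * conj ((χ₂ (diagUnit (t : borelAdelic F E c N).2 0) : ℂˣ) : ℂ) *
        ∫ k, φ (k : (quasiSplit F E c N).Adelic) * conj (ψ (k : (quasiSplit F E c N).Adelic)) ∂μK := by
  rw [← integral_const_mul]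
  refine integral_congr_ae (Filter.Eventually.of_forall fun k => ?_)
  dsimp only
  rw [hφ.borel_mul_diagUnit _ _ (t : borelAdelic F E c N).2, hψ.borel_mul_diagUnit _ _ (t : borelAdelic F E c N).2, map_mul]
  ring

/-! ## §2 The density `x ↦ χ_α(x)·conj χ_β(x)·P` on the ideles: measurable, bounded, `Eˣ`- and `ρ(ℝ_{>0})`-invariant -/

omit [NumberField F] [NeZero N] in
/-- Hecke characters are continuous as `ℂ`-valued functions on `𝕀_E`. [folklore] -/
theorem continuous_heckeCharacter_coe (χ : HeckeCharacter E) : Continuous fun x : (AdeleRing (𝓞 E) E)ˣ => ((χ x : ℂˣ) : ℂ) :=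
  Units.continuous_val.comp (map_continuous χ)

omit [NumberField F] [NeZero N] in
/-- The density `χ_α·conj χ_β·P` is Borel measurable. [folklore] -/
theorem measurable_charPair_mul [MeasurableSpace (AdeleRing (𝓞 E) E)ˣ] [BorelSpace (AdeleRing (𝓞 E) E)ˣ] (χ₁ χ₂ : HeckeCharacter E) (P : ℂ) :
    Measurable fun x : (AdeleRing (𝓞 E) E)ˣ => ((χ₁ x : ℂˣ) : ℂ) * conj ((χ₂ x : ℂˣ) : ℂ) * P :=
  (((continuous_heckeCharacter_coe χ₁).mul (Complex.continuous_conj.comp (continuous_heckeCharacter_coe χ₂))).mul continuous_const).measurable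

omit [NumberField F] [NeZero N] in
/-- For UNITARY `χ_α, χ_β`: `‖χ_α(x)·conj χ_β(x)·P‖ ≤ ‖P‖` (with equality). [cite: MoeglinWaldspurger1995, II.1.7] -/
theorem norm_charPair_mul_le {χ₁ χ₂ : HeckeCharacter E} (hχ₁ : χ₁.IsUnitary) (hχ₂ : χ₂.IsUnitary) (P : ℂ) (x : (AdeleRing (𝓞 E) E)ˣ) :
    ‖((χ₁ x : ℂˣ) : ℂ) * conj ((χ₂ x : ℂˣ) : ℂ) * P‖ ≤ ‖P‖ := by
  rw [norm_mul, norm_mul, Complex.norm_conj, hχ₁ x, hχ₂ x, one_mul, one_mul]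

omit [NumberField F] [NeZero N] in
/-- The density is invariant under the principal ideles `Eˣ` (Hecke characters are trivial there, ★ `map_principal`). [cite: MoeglinWaldspurger1995, II.1.7] -/
theorem charPair_mul_principal_mul (χ₁ χ₂ : HeckeCharacter E) (P : ℂ) :
    ∀ k ∈ principalIdeles E, ∀ x : (AdeleRing (𝓞 E) E)ˣ,
      ((χ₁ (k * x) : ℂˣ) : ℂ) * conj ((χ₂ (k * x) : ℂˣ) : ℂ) * P = ((χ₁ x : ℂˣ) : ℂ) * conj ((χ₂ x : ℂˣ) : ℂ) * P := fun k hk x => by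
  rw [map_mul, map_mul, HeckeCharacter.map_principal χ₁ hk, HeckeCharacter.map_principal χ₂ hk, one_mul, one_mul]

omit [NumberField F] [NeZero N] in
/-- The density is invariant under the positive real ideles `ρ(r)` when both characters are NORMALISED, `χᵢ(ρ(r)) = 1` («trivial on the split component»).
[cite: MoeglinWaldspurger1995, II.1.7] -/
theorem charPair_mul_posRealIdele_mul {χ₁ χ₂ : HeckeCharacter E} (h₁ : ∀ r : ℝ≥0ˣ, χ₁ (posRealIdele E r) = 1) (h₂ : ∀ r : ℝ≥0ˣ, χ₂ (posRealIdele E r) = 1) (P : ℂ) :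
    ∀ (r : ℝ≥0ˣ) (x : (AdeleRing (𝓞 E) E)ˣ),
      ((χ₁ (posRealIdele E r * x) : ℂˣ) : ℂ) * conj ((χ₂ (posRealIdele E r * x) : ℂˣ) : ℂ) * P = ((χ₁ x : ℂˣ) : ℂ) * conj ((χ₂ x : ℂˣ) : ℂ) * P := fun r x => by
  rw [map_mul, map_mul, h₁ r, h₂ r, one_mul, one_mul]

omit [NumberField F] [NeZero N] in
/-- **`(c ⊗ 1) ρ(r) = ρ(r)`**: the conjugation of `𝔸_E` fixes the positive real ideles (★ `smul_posRealIdele`; the idele packaging `Units.map` of ★ `conjAdele` is the Galois action `c • ·`).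
[folklore] -/
theorem unitsMap_conjAdele_posRealIdele (r : ℝ≥0ˣ) :
    Units.map (conjAdele F E c : AdeleRing (𝓞 E) E →+* AdeleRing (𝓞 E) E).toMonoidHom (posRealIdele E r) = posRealIdele E r :=
  (Units.ext rfl : Units.map (conjAdele F E c : AdeleRing (𝓞 E) E →+* AdeleRing (𝓞 E) E).toMonoidHom (posRealIdele E r) = c • posRealIdele E r).trans
    (smul_posRealIdele F E c r)

omit [NumberField F] [NeZero N] in
/-- **The reflected character of a normalised character is normalised**: `χ(ρ(r)) = 1 ⇒ χʷ(ρ(r)) = 1` (`χʷ(a) = χ((c ⊗ 1)a)⁻¹`, `(c ⊗ 1)ρ(r) = ρ(r)`). [cite: MoeglinWaldspurger1995, II.1.7] -/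
theorem reflectChar_posRealIdele {χ : HeckeCharacter E} (hρ : ∀ r : ℝ≥0ˣ, χ (posRealIdele E r) = 1) :
    ∀ r : ℝ≥0ˣ, reflectChar c χ (posRealIdele E r) = 1 := fun r => by
  rw [reflectChar_apply, unitsMap_conjAdele_posRealIdele, hρ r, inv_one]

/-! ## §3 Adapters: `χ`-sections in the binder shapes of the ★ Maass–Selberg layer (`unipotentInBorel`, `arithmeticBorel`) -/

variable {χ : HeckeCharacter E} {φ : (quasiSplit F E c N).Adelic → ℂ}

omit [MeasurableSpace (quasiSplit F E c N).Adelic] in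
/-- `χ`-sections are left-invariant under `N(𝔸_F)` in the `unipotentInBorel` spelling of the ★ Maass–Selberg heads (★ `IsChiSection.unipotent_mul`). [cite: MoeglinWaldspurger1995, I.2.17] -/
theorem _root_.Summit.HodgeConjecture.HodgeConjecture.Cruxes.H413.K2E1CharacterEisensteinU2Defs.IsChiSection.unipotentInBorel_mul (hφ : IsChiSection χ φ) :
    ∀ (n : ↥(unipotentInBorel F E c N)) (y : (quasiSplit F E c N).Adelic), φ (((n : borelAdelic F E c N) : (quasiSplit F E c N).Adelic) * y) = φ y := fun n y =>
  hφ.unipotent_mul ⟨((n : borelAdelic F E c N) : (quasiSplit F E c N).Adelic), (mem_unipotentInBorel_iff _).1 n.2⟩ y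

omit [MeasurableSpace (quasiSplit F E c N).Adelic] in
/-- `χ`-sections are left-invariant under `B(F)` in the `arithmeticBorel` spelling of the ★ Maass–Selberg heads (★ `IsChiSection.toAdelic_mul` ∘ ★ `forall_arithmeticBorel_iff`).
[cite: MoeglinWaldspurger1995, II.1.5] -/
theorem _root_.Summit.HodgeConjecture.HodgeConjecture.Cruxes.H413.K2E1CharacterEisensteinU2Defs.IsChiSection.arithmeticBorel_mul (hφ : IsChiSection χ φ) :
    ∀ b ∈ arithmeticBorel F E c N, ∀ y : (quasiSplit F E c N).Adelic, φ ((b : (quasiSplit F E c N).Adelic) * y) = φ y :=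
  forall_arithmeticBorel_iff.2 hφ.toAdelic_mul

end Generic

/-! ## §4 The CM pair `(L⁺, L, conj)`: the Maass–Selberg relation for `χ`-sections of `U(1,1)`, all four `K_U`-average data discharged -/

section CM

variable (L : Type) [Field L] [NumberField L] [IsCMField L]
variable [MeasurableSpace (quasiSplit (↥(maximalRealSubfield L)) L (IsCMField.complexConj L) 2).Adelic] [BorelSpace (quasiSplit (↥(maximalRealSubfield L)) L (IsCMField.complexConj L) 2).Adelic]
variable [MeasurableSpace (AdeleRing (𝓞 L) L)ˣ] [BorelSpace (AdeleRing (𝓞 L) L)ˣ]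

/-- **THE MAASS–SELBERG RELATION FOR `χ`-SECTIONS OF `U(J₂)` AT THE CM PAIR** = ★ «CM-FINAL-2» ED. 2 `maassSelberg_flatSectionU_cm_two_final′` for continuous bounded `χ₁`-∕`χ₂`-sections
`φ, φ′` (`IsChiSection`, ★ DEFS LEAF), `χ₁, χ₂` UNITARY and NORMALISED (`χᵢ(ρ(r)) = 1`), on the sub-tube `1 < Re z′ < Re z`: the structural binders `hφN hφB hφ′N hφ′B` (§3) and ALL FOUR
`K_U`-AVERAGE DATA `hΞ₁…hΞ₄` DISCHARGED — `Ξ₁ = χ₁χ̄₂·⟨φ,φ′⟩_K`, `Ξ₂ = χ₁·conj χ₂ʷ·⟨φ,φ̃′⟩_K`, `Ξ₃ = χ₁ʷχ̄₂·⟨φ̃,φ′⟩_K`, `Ξ₄ = χ₁ʷ·conj χ₂ʷ·⟨φ̃,φ̃′⟩_K` (§1 on the pairs, row 3 ★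
`isChiSection_intertwinedCoeff_two` for `φ̃, φ̃′`, §2 for the idele-side conditions), written out inside the four idele-class brackets.  SURVIVOR: `hdec′` ONLY (as in ★ (R6k)₂
`maassSelberg_flatSectionU_cm_two_final_spherical`, whose `χ = 1`, `φ ≡ φ₀` case this generalises: there `⟨φ,φ′⟩_K = m·φ₀·conj φ₀′`, `φ̃ ≡ c(z)φ₀`).
[cite: MoeglinWaldspurger1995, II.1.7 and IV.2.3] [cite: Arthur1980TraceFormulaII, §4] [cite: Garrett2018, §11.3] -/
theorem maassSelberg_chiSection_cm_two
    (μ : Measure (quasiSplit (↥(maximalRealSubfield L)) L (IsCMField.complexConj L) 2).automorphicQuotient) [(quasiSplit (↥(maximalRealSubfield L)) L (IsCMField.complexConj L) 2).IsAutomorphicMeasure μ]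
    (νG : Measure (quasiSplit (↥(maximalRealSubfield L)) L (IsCMField.complexConj L) 2).Adelic) [νG.IsHaarMeasure] [νG.IsInvInvariant]
    (μK : Measure ((standardMaximalCompactGL 2 L).comap (adelicVal (↥(maximalRealSubfield L)) L (IsCMField.complexConj L) 2 ((StdForm.antidiagonal 2).over L)) : Subgroup (quasiSplit (↥(maximalRealSubfield L)) L (IsCMField.complexConj L) 2).Adelic))
    [μK.IsHaarMeasure]
    (νI : Measure (AdeleRing (𝓞 L) L)ˣ) [νI.IsHaarMeasure]
    {𝓕I : Set (AdeleRing (𝓞 L) L)ˣ} (h𝓕I : IsIdeleClassDomain L 𝓕I)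
    (ν : Measure ↥(adelicUnipotent (↥(maximalRealSubfield L)) L (IsCMField.complexConj L) 2)) [ν.IsHaarMeasure]
    {𝓕 : Set ↥(adelicUnipotent (↥(maximalRealSubfield L)) L (IsCMField.complexConj L) 2)} (h𝓕N : IsFundamentalDomain ↥(rationalUnipotent (↥(maximalRealSubfield L)) L (IsCMField.complexConj L) 2) 𝓕 ν) (h𝓕1 : ν 𝓕 = 1)
    (h𝓕c : IsCompact (closure 𝓕)) :
    ∃ cμ K : ℝ, 0 < cμ ∧ 0 < K ∧
      ∀ {β : (quasiSplit (↥(maximalRealSubfield L)) L (IsCMField.complexConj L) 2).Adelic → ℝ≥0∞}, IsCoveringWeight ((arithmeticBorel (↥(maximalRealSubfield L)) L (IsCMField.complexConj L) 2).map (quasiSplit (↥(maximalRealSubfield L)) L (IsCMField.complexConj L) 2).arithmeticSubgroup.subtype) β →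
      ∀ {T : ℝ≥0}, 1 ≤ T →
      ∀ {χ₁ χ₂ : HeckeCharacter L}, χ₁.IsUnitary → (∀ r : ℝ≥0ˣ, χ₁ (posRealIdele L r) = 1) → χ₂.IsUnitary → (∀ r : ℝ≥0ˣ, χ₂ (posRealIdele L r) = 1) →
      ∀ {φ φ' : (quasiSplit (↥(maximalRealSubfield L)) L (IsCMField.complexConj L) 2).Adelic → ℂ},
      Continuous φ → IsChiSection χ₁ φ → ∀ {Cφ : ℝ}, (∀ x, ‖φ x‖ ≤ Cφ) →
      Continuous φ' → IsChiSection χ₂ φ' → ∀ {Cφ' : ℝ}, (∀ x, ‖φ' x‖ ≤ Cφ') →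
      ∀ {z z' : ℂ}, 1 < z'.re → z'.re < z.re →
      -- NAMED: the decay `hdec′` of `E(f′_{z′}) − E(f′_{z′})_B` on the Siegel region `{H > T}` — NOTHING ELSE (`hφN hφB hφ′N hφ′B` and the four `K_U`-average data `hΞ₁…hΞ₄` are DISCHARGED)
        ∀ {M₁ : ℝ}, (∀ g : (quasiSplit (↥(maximalRealSubfield L)) L (IsCMField.complexConj L) 2).Adelic, T < borelHeight g →
          ‖eisensteinSeriesU (flatSectionU φ' z') g - borelConstantTerm ν 𝓕 (eisensteinSeriesU (flatSectionU φ' z')) g‖ ≤ M₁) →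
        ∫ x, (quasiSplit (↥(maximalRealSubfield L)) L (IsCMField.complexConj L) 2).quotFun (truncation ν 𝓕 T (eisensteinSeriesU (flatSectionU φ z))) x * conj ((quasiSplit (↥(maximalRealSubfield L)) L (IsCMField.complexConj L) 2).quotFun (truncation ν 𝓕 T (eisensteinSeriesU (flatSectionU φ' z'))) x) ∂μ =
          (cμ : ℂ) * ((K : ℂ) *
            ((((T : ℝ) : ℂ) ^ (z + conj z' - 1) / (z + conj z' - 1)) * (∫ x in {x : (AdeleRing (𝓞 L) L)ˣ | (IdeleClassGroup.ideleNorm L x : ℝ) ≤ 1} ∩ 𝓕I, ((IdeleClassGroup.ideleNorm L x : ℝ) : ℂ) * (((χ₁ x : ℂˣ) : ℂ) * conj ((χ₂ x : ℂˣ) : ℂ) *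
                  (∫ k, φ (k : (quasiSplit (↥(maximalRealSubfield L)) L (IsCMField.complexConj L) 2).Adelic) * conj (φ' (k : (quasiSplit (↥(maximalRealSubfield L)) L (IsCMField.complexConj L) 2).Adelic)) ∂μK)) ∂νI)
              + (((T : ℝ) : ℂ) ^ (z - conj z') / (z - conj z')) * (∫ x in {x : (AdeleRing (𝓞 L) L)ˣ | (IdeleClassGroup.ideleNorm L x : ℝ) ≤ 1} ∩ 𝓕I, ((IdeleClassGroup.ideleNorm L x : ℝ) : ℂ) * (((χ₁ x : ℂˣ) : ℂ) * conj ((reflectChar (IsCMField.complexConj L) χ₂ x : ℂˣ) : ℂ) *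
                  (∫ k, φ (k : (quasiSplit (↥(maximalRealSubfield L)) L (IsCMField.complexConj L) 2).Adelic) * conj ((fun g : (quasiSplit (↥(maximalRealSubfield L)) L (IsCMField.complexConj L) 2).Adelic => (∫ v : ↥(adelicUnipotent (↥(maximalRealSubfield L)) L (IsCMField.complexConj L) 2), flatSectionU φ' z' ((quasiSplit (↥(maximalRealSubfield L)) L (IsCMField.complexConj L) 2).toAdelic (weylLongU ((IsCMField.complexConj L : L ≃ₐ[↥(maximalRealSubfield L)] L) : L →+* L) (rfl : (StdForm.antidiagonal 2).over L = (StdForm.antidiagonal 2).over L)) * ((v : (quasiSplit (↥(maximalRealSubfield L)) L (IsCMField.complexConj L) 2).Adelic) * g)) ∂ν) * ((borelHeight g : ℝ) : ℂ) ^ (z' - 1)) (k : (quasiSplit (↥(maximalRealSubfield L)) L (IsCMField.complexConj L) 2).Adelic)) ∂μK)) ∂νI)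
              - (((T : ℝ) : ℂ) ^ (-(z - conj z')) / (z - conj z')) * (∫ x in {x : (AdeleRing (𝓞 L) L)ˣ | (IdeleClassGroup.ideleNorm L x : ℝ) ≤ 1} ∩ 𝓕I, ((IdeleClassGroup.ideleNorm L x : ℝ) : ℂ) * (((reflectChar (IsCMField.complexConj L) χ₁ x : ℂˣ) : ℂ) * conj ((χ₂ x : ℂˣ) : ℂ) *
                  (∫ k, (fun g : (quasiSplit (↥(maximalRealSubfield L)) L (IsCMField.complexConj L) 2).Adelic => (∫ v : ↥(adelicUnipotent (↥(maximalRealSubfield L)) L (IsCMField.complexConj L) 2), flatSectionU φ z ((quasiSplit (↥(maximalRealSubfield L)) L (IsCMField.complexConj L) 2).toAdelic (weylLongU ((IsCMField.complexConj L : L ≃ₐ[↥(maximalRealSubfield L)] L) : L →+* L) (rfl : (StdForm.antidiagonal 2).over L = (StdForm.antidiagonal 2).over L)) * ((v : (quasiSplit (↥(maximalRealSubfield L)) L (IsCMField.complexConj L) 2).Adelic) * g)) ∂ν) * ((borelHeight g : ℝ) : ℂ) ^ (z - 1)) (k : (quasiSplit (↥(maximalRealSubfield L)) L (IsCMField.complexConj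 L) 2).Adelic) * conj (φ' (k : (quasiSplit (↥(maximalRealSubfield L)) L (IsCMField.complexConj L) 2).Adelic)) ∂μK)) ∂νI)
              - (((T : ℝ) : ℂ) ^ (-(z + conj z' - 1)) / (z + conj z' - 1)) * (∫ x in {x : (AdeleRing (𝓞 L) L)ˣ | (IdeleClassGroup.ideleNorm L x : ℝ) ≤ 1} ∩ 𝓕I, ((IdeleClassGroup.ideleNorm L x : ℝ) : ℂ) * (((reflectChar (IsCMField.complexConj L) χ₁ x : ℂˣ) : ℂ) * conj ((reflectChar (IsCMField.complexConj L) χ₂ x : ℂˣ) : ℂ) *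
                  (∫ k, (fun g : (quasiSplit (↥(maximalRealSubfield L)) L (IsCMField.complexConj L) 2).Adelic => (∫ v : ↥(adelicUnipotent (↥(maximalRealSubfield L)) L (IsCMField.complexConj L) 2), flatSectionU φ z ((quasiSplit (↥(maximalRealSubfield L)) L (IsCMField.complexConj L) 2).toAdelic (weylLongU ((IsCMField.complexConj L : L ≃ₐ[↥(maximalRealSubfield L)] L) : L →+* L) (rfl : (StdForm.antidiagonal 2).over L = (StdForm.antidiagonal 2).over L)) * ((v : (quasiSplit (↥(maximalRealSubfield L)) L (IsCMField.complexConj L) 2).Adelic) * g)) ∂ν) * ((borelHeight g : ℝ) : ℂ) ^ (z - 1)) (k : (quasiSplit (↥(maximalRealSubfield L)) L (IsCMField.complexConj L) 2).Adelic) * conj ((fun g : (quasiSplit (↥(maximalRealSubfield L)) L (IsCMField.complexConj L) 2).Adelic => (∫ v : ↥(adelicUnipotent (↥(maximalRealSubfield L)) L (IsCMField.complexConj L) 2), flatSectionU φ' z' ((quasiSplit (↥(maximalRealSubfield L)) L (IsCMField.complexConj L) 2).toAdelic (weylLongU ((IsCMField.complexConj L : L ≃ₐ[↥(maximalRealSubfield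 L)] L) : L →+* L) (rfl : (StdForm.antidiagonal 2).over L = (StdForm.antidiagonal 2).over L)) * ((v : (quasiSplit (↥(maximalRealSubfield L)) L (IsCMField.complexConj L) 2).Adelic) * g)) ∂ν) * ((borelHeight g : ℝ) : ℂ) ^ (z' - 1)) (k : (quasiSplit (↥(maximalRealSubfield L)) L (IsCMField.complexConj L) 2).Adelic)) ∂μK)) ∂νI))) := by
  obtain ⟨cμ, K, hcμ, hK, h⟩ := maassSelberg_flatSectionU_cm_two_final' L μ νG μK νI h𝓕I ν h𝓕N h𝓕1 h𝓕c
  refine ⟨cμ, K, hcμ, hK, ?_⟩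
  intro β hβ T hT χ₁ χ₂ hχ₁ hρ₁ hχ₂ hρ₂ φ φ' hφc hφ Cφ hφC hφ'c hφ' Cφ' hφ'C z z' hz' hzz' M₁ hdec'
  have hc : IsCMField.complexConj L * IsCMField.complexConj L = 1 := AlgEquiv.ext fun x => IsCMField.complexConj_apply_apply L x
  have hc1 : IsCMField.complexConj L ≠ 1 := IsCMField.complexConj_ne_one L
  -- the intertwined coefficients are `χᵢʷ`-sections (row 3 ★ `isChiSection_intertwinedCoeff_two`)
  have hφt := isChiSection_intertwinedCoeff_two hc hc1 ν hφ hφc.measurable z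
  have hφ't := isChiSection_intertwinedCoeff_two hc hc1 ν hφ' hφ'c.measurable z'
  have hχ₁w : (reflectChar (IsCMField.complexConj L) χ₁).IsUnitary := IsUnitary.reflectChar hχ₁
  have hχ₂w : (reflectChar (IsCMField.complexConj L) χ₂).IsUnitary := IsUnitary.reflectChar hχ₂
  have hρ₁w : ∀ r : ℝ≥0ˣ, reflectChar (IsCMField.complexConj L) χ₁ (posRealIdele L r) = 1 := reflectChar_posRealIdele hρ₁
  have hρ₂w : ∀ r : ℝ≥0ˣ, reflectChar (IsCMField.complexConj L) χ₂ (posRealIdele L r) = 1 := reflectChar_posRealIdele hρ₂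
  exact h hβ hT hφc hφ.unipotentInBorel_mul hφ.arithmeticBorel_mul hφC hφ'c hφ'.unipotentInBorel_mul hφ'.arithmeticBorel_mul hφ'C hz' hzz' hdec'
    (Ξ₁ := fun x : (AdeleRing (𝓞 L) L)ˣ => ((χ₁ x : ℂˣ) : ℂ) * conj ((χ₂ x : ℂˣ) : ℂ) *
                  (∫ k, φ (k : (quasiSplit (↥(maximalRealSubfield L)) L (IsCMField.complexConj L) 2).Adelic) * conj (φ' (k : (quasiSplit (↥(maximalRealSubfield L)) L (IsCMField.complexConj L) 2).Adelic)) ∂μK)) (Ξ₂ := fun x : (AdeleRing (𝓞 L) L)ˣ => ((χ₁ x : ℂˣ) : ℂ) * conj ((reflectChar (IsCMField.complexConj L) χ₂ x : ℂˣ) : ℂ) *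
                  (∫ k, φ (k : (quasiSplit (↥(maximalRealSubfield L)) L (IsCMField.complexConj L) 2).Adelic) * conj ((fun g : (quasiSplit (↥(maximalRealSubfield L)) L (IsCMField.complexConj L) 2).Adelic => (∫ v : ↥(adelicUnipotent (↥(maximalRealSubfield L)) L (IsCMField.complexConj L) 2), flatSectionU φ' z' ((quasiSplit (↥(maximalRealSubfield L)) L (IsCMField.complexConj L) 2).toAdelic (weylLongU ((IsCMField.complexConj L : L ≃ₐ[↥(maximalRealSubfield L)] L) : L →+* L) (rfl : (StdForm.antidiagonal 2).over L = (StdForm.antidiagonal 2).over L)) * ((v : (quasiSplit (↥(maximalRealSubfield L)) L (IsCMField.complexConj L) 2).Adelic) * g)) ∂ν) * ((borelHeight g : ℝ) : ℂ) ^ (z' - 1)) (k : (quasiSplit (↥(maximalRealSubfield L)) L (IsCMField.complexConj L) 2).Adelic)) ∂μK))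
    (Ξ₃ := fun x : (AdeleRing (𝓞 L) L)ˣ => ((reflectChar (IsCMField.complexConj L) χ₁ x : ℂˣ) : ℂ) * conj ((χ₂ x : ℂˣ) : ℂ) *
                  (∫ k, (fun g : (quasiSplit (↥(maximalRealSubfield L)) L (IsCMField.complexConj L) 2).Adelic => (∫ v : ↥(adelicUnipotent (↥(maximalRealSubfield L)) L (IsCMField.complexConj L) 2), flatSectionU φ z ((quasiSplit (↥(maximalRealSubfield L)) L (IsCMField.complexConj L) 2).toAdelic (weylLongU ((IsCMField.complexConj L : L ≃ₐ[↥(maximalRealSubfield L)] L) : L →+* L) (rfl : (StdForm.antidiagonal 2).over L = (StdForm.antidiagonal 2).over L)) * ((v : (quasiSplit (↥(maximalRealSubfield L)) L (IsCMField.complexConj L) 2).Adelic) * g)) ∂ν) * ((borelHeight g : ℝ) : ℂ) ^ (z - 1)) (k : (quasiSplit (↥(maximalRealSubfield L)) L (IsCMField.complexConj L) 2).Adelic) * conj (φ' (k : (quasiSplit (↥(maximalRealSubfield L)) L (IsCMField.complexConj L) 2).Adelic)) ∂μK)) (Ξ₄ := fun x : (AdeleRing (𝓞 L) L)ˣ =>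 ((reflectChar (IsCMField.complexConj L) χ₁ x : ℂˣ) : ℂ) * conj ((reflectChar (IsCMField.complexConj L) χ₂ x : ℂˣ) : ℂ) *
                  (∫ k, (fun g : (quasiSplit (↥(maximalRealSubfield L)) L (IsCMField.complexConj L) 2).Adelic => (∫ v : ↥(adelicUnipotent (↥(maximalRealSubfield L)) L (IsCMField.complexConj L) 2), flatSectionU φ z ((quasiSplit (↥(maximalRealSubfield L)) L (IsCMField.complexConj L) 2).toAdelic (weylLongU ((IsCMField.complexConj L : L ≃ₐ[↥(maximalRealSubfield L)] L) : L →+* L) (rfl : (StdForm.antidiagonal 2).over L = (StdForm.antidiagonal 2).over L)) * ((v : (quasiSplit (↥(maximalRealSubfield L)) L (IsCMField.complexConj L) 2).Adelic) * g)) ∂ν) * ((borelHeight g : ℝ) : ℂ) ^ (z - 1)) (k : (quasiSplit (↥(maximalRealSubfield L)) L (IsCMField.complexConj L) 2).Adelic) * conj ((fun g : (quasiSplit (↥(maximalRealSubfield L)) L (IsCMField.complexConj L) 2).Adelic => (∫ v : ↥(adelicUnipotent (↥(maximalRealSubfield L)) L (IsCMField.complexConj L) 2), flatSectionU φ' z'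 ((quasiSplit (↥(maximalRealSubfield L)) L (IsCMField.complexConj L) 2).toAdelic (weylLongU ((IsCMField.complexConj L : L ≃ₐ[↥(maximalRealSubfield L)] L) : L →+* L) (rfl : (StdForm.antidiagonal 2).over L = (StdForm.antidiagonal 2).over L)) * ((v : (quasiSplit (↥(maximalRealSubfield L)) L (IsCMField.complexConj L) 2).Adelic) * g)) ∂ν) * ((borelHeight g : ℝ) : ℂ) ^ (z' - 1)) (k : (quasiSplit (↥(maximalRealSubfield L)) L (IsCMField.complexConj L) 2).Adelic)) ∂μK))
    (measurable_charPair_mul χ₁ χ₂ _) (norm_charPair_mul_le hχ₁ hχ₂ _) (charPair_mul_principal_mul χ₁ χ₂ _) (charPair_mul_posRealIdele_mul hρ₁ hρ₂ _)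
      (fun t => integral_chiSection_mul_conj_chiSection_torus_mul μK hφ hφ' t)
    (measurable_charPair_mul χ₁ _ _) (norm_charPair_mul_le hχ₁ hχ₂w _) (charPair_mul_principal_mul χ₁ _ _) (charPair_mul_posRealIdele_mul hρ₁ hρ₂w _)
      (fun t => integral_chiSection_mul_conj_chiSection_torus_mul μK hφ hφ't t)
    (measurable_charPair_mul _ χ₂ _) (norm_charPair_mul_le hχ₁w hχ₂ _) (charPair_mul_principal_mul _ χ₂ _) (charPair_mul_posRealIdele_mul hρ₁w hρ₂ _)
      (fun t => integral_chiSection_mul_conj_chiSection_torus_mul μK hφt hφ' t)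
    (measurable_charPair_mul _ _ _) (norm_charPair_mul_le hχ₁w hχ₂w _) (charPair_mul_principal_mul _ _ _) (charPair_mul_posRealIdele_mul hρ₁w hρ₂w _)
      (fun t => integral_chiSection_mul_conj_chiSection_torus_mul μK hφt hφ't t)

/-- **COROLLARY — ONE CHARACTER (`χ₁ = χ₂ = χ`), THE CASE OF `‖Λ^T E(f_z)‖²`-TYPE PAIRINGS**: the outer densities are the CONSTANTS `⟨φ,φ′⟩_K` and `⟨φ̃,φ̃′⟩_K` (`χ·χ̄ = 1 = χʷ·conj χʷ` for
unitary `χ`), so the first and last brackets are `κ·⟨φ,φ′⟩_K`, `κ·⟨φ̃,φ̃′⟩_K` with the POSITIVE scalar `κ = ∫_{𝓕_I∩{‖x‖≤1}} ‖x‖ dν_I` (★ `idelicBracket_pos`); the cross brackets keep the idele class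
character `χ·conj χʷ = χ·(χ ∘ c)` (they vanish unless it is trivial — FILE 2's orthogonality input, not claimed here).  Survivor `hdec′` only.
[cite: MoeglinWaldspurger1995, II.1.7 and IV.2.3] [cite: Garrett2018, §11.3] -/
theorem maassSelberg_chiSection_cm_two_self
    (μ : Measure (quasiSplit (↥(maximalRealSubfield L)) L (IsCMField.complexConj L) 2).automorphicQuotient) [(quasiSplit (↥(maximalRealSubfield L)) L (IsCMField.complexConj L) 2).IsAutomorphicMeasure μ]
    (νG : Measure (quasiSplit (↥(maximalRealSubfield L)) L (IsCMField.complexConj L) 2).Adelic) [νG.IsHaarMeasure] [νG.IsInvInvariant]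
    (μK : Measure ((standardMaximalCompactGL 2 L).comap (adelicVal (↥(maximalRealSubfield L)) L (IsCMField.complexConj L) 2 ((StdForm.antidiagonal 2).over L)) : Subgroup (quasiSplit (↥(maximalRealSubfield L)) L (IsCMField.complexConj L) 2).Adelic))
    [μK.IsHaarMeasure]
    (νI : Measure (AdeleRing (𝓞 L) L)ˣ) [νI.IsHaarMeasure]
    {𝓕I : Set (AdeleRing (𝓞 L) L)ˣ} (h𝓕I : IsIdeleClassDomain L 𝓕I)
    (ν : Measure ↥(adelicUnipotent (↥(maximalRealSubfield L)) L (IsCMField.complexConj L) 2)) [ν.IsHaarMeasure]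
    {𝓕 : Set ↥(adelicUnipotent (↥(maximalRealSubfield L)) L (IsCMField.complexConj L) 2)} (h𝓕N : IsFundamentalDomain ↥(rationalUnipotent (↥(maximalRealSubfield L)) L (IsCMField.complexConj L) 2) 𝓕 ν) (h𝓕1 : ν 𝓕 = 1)
    (h𝓕c : IsCompact (closure 𝓕)) :
    ∃ cμ K : ℝ, 0 < cμ ∧ 0 < K ∧
      ∀ {β : (quasiSplit (↥(maximalRealSubfield L)) L (IsCMField.complexConj L) 2).Adelic → ℝ≥0∞}, IsCoveringWeight ((arithmeticBorel (↥(maximalRealSubfield L)) L (IsCMField.complexConj L) 2).map (quasiSplit (↥(maximalRealSubfield L)) L (IsCMField.complexConj L) 2).arithmeticSubgroup.subtype) β →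
      ∀ {T : ℝ≥0}, 1 ≤ T →
      ∀ {χ : HeckeCharacter L}, χ.IsUnitary → (∀ r : ℝ≥0ˣ, χ (posRealIdele L r) = 1) →
      ∀ {φ φ' : (quasiSplit (↥(maximalRealSubfield L)) L (IsCMField.complexConj L) 2).Adelic → ℂ},
      Continuous φ → IsChiSection χ φ → ∀ {Cφ : ℝ}, (∀ x, ‖φ x‖ ≤ Cφ) →
      Continuous φ' → IsChiSection χ φ' → ∀ {Cφ' : ℝ}, (∀ x, ‖φ' x‖ ≤ Cφ') →
      ∀ {z z' : ℂ}, 1 < z'.re → z'.re < z.re →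
      -- NAMED: `hdec′` only; brackets 1 and 4 are `κ·⟨φ,φ′⟩_K`, `κ·⟨φ̃,φ̃′⟩_K`
        ∀ {M₁ : ℝ}, (∀ g : (quasiSplit (↥(maximalRealSubfield L)) L (IsCMField.complexConj L) 2).Adelic, T < borelHeight g →
          ‖eisensteinSeriesU (flatSectionU φ' z') g - borelConstantTerm ν 𝓕 (eisensteinSeriesU (flatSectionU φ' z')) g‖ ≤ M₁) →
        ∫ x, (quasiSplit (↥(maximalRealSubfield L)) L (IsCMField.complexConj L) 2).quotFun (truncation ν 𝓕 T (eisensteinSeriesU (flatSectionU φ z))) x * conj ((quasiSplit (↥(maximalRealSubfield L)) L (IsCMField.complexConj L) 2).quotFun (truncation ν 𝓕 T (eisensteinSeriesU (flatSectionU φ' z'))) x) ∂μ =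
          (cμ : ℂ) * ((K : ℂ) *
            ((((T : ℝ) : ℂ) ^ (z + conj z' - 1) / (z + conj z' - 1)) * ((∫ x in {x : (AdeleRing (𝓞 L) L)ˣ | (IdeleClassGroup.ideleNorm L x : ℝ) ≤ 1} ∩ 𝓕I, ((IdeleClassGroup.ideleNorm L x : ℝ) : ℂ) ∂νI) *
                  (∫ k, φ (k : (quasiSplit (↥(maximalRealSubfield L)) L (IsCMField.complexConj L) 2).Adelic) * conj (φ' (k : (quasiSplit (↥(maximalRealSubfield L)) L (IsCMField.complexConj L) 2).Adelic)) ∂μK))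
              + (((T : ℝ) : ℂ) ^ (z - conj z') / (z - conj z')) * (∫ x in {x : (AdeleRing (𝓞 L) L)ˣ | (IdeleClassGroup.ideleNorm L x : ℝ) ≤ 1} ∩ 𝓕I, ((IdeleClassGroup.ideleNorm L x : ℝ) : ℂ) * (((χ x : ℂˣ) : ℂ) * conj ((reflectChar (IsCMField.complexConj L) χ x : ℂˣ) : ℂ) *
                  (∫ k, φ (k : (quasiSplit (↥(maximalRealSubfield L)) L (IsCMField.complexConj L) 2).Adelic) * conj ((fun g : (quasiSplit (↥(maximalRealSubfield L)) L (IsCMField.complexConj L) 2).Adelic => (∫ v : ↥(adelicUnipotent (↥(maximalRealSubfield L)) L (IsCMField.complexConj L) 2), flatSectionU φ' z' ((quasiSplit (↥(maximalRealSubfield L)) L (IsCMField.complexConj L) 2).toAdelic (weylLongU ((IsCMField.complexConj L : L ≃ₐ[↥(maximalRealSubfield L)] L) : L →+* L) (rfl : (StdForm.antidiagonal 2).over L = (StdForm.antidiagonal 2).over L)) * ((v : (quasiSplit (↥(maximalRealSubfield L)) L (IsCMField.complexConj L) 2).Adelic) * g)) ∂ν) * ((borelHeight g : ℝ) : ℂ)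 ^ (z' - 1)) (k : (quasiSplit (↥(maximalRealSubfield L)) L (IsCMField.complexConj L) 2).Adelic)) ∂μK)) ∂νI)
              - (((T : ℝ) : ℂ) ^ (-(z - conj z')) / (z - conj z')) * (∫ x in {x : (AdeleRing (𝓞 L) L)ˣ | (IdeleClassGroup.ideleNorm L x : ℝ) ≤ 1} ∩ 𝓕I, ((IdeleClassGroup.ideleNorm L x : ℝ) : ℂ) * (((reflectChar (IsCMField.complexConj L) χ x : ℂˣ) : ℂ) * conj ((χ x : ℂˣ) : ℂ) *
                  (∫ k, (fun g : (quasiSplit (↥(maximalRealSubfield L)) L (IsCMField.complexConj L) 2).Adelic => (∫ v : ↥(adelicUnipotent (↥(maximalRealSubfield L)) L (IsCMField.complexConj L) 2), flatSectionU φ z ((quasiSplit (↥(maximalRealSubfield L)) L (IsCMField.complexConj L) 2).toAdelic (weylLongU ((IsCMField.complexConj L : L ≃ₐ[↥(maximalRealSubfield L)] L) : L →+* L) (rfl : (StdForm.antidiagonal 2).over L = (StdForm.antidiagonal 2).over L)) * ((v : (quasiSplit (↥(maximalRealSubfield L)) L (IsCMField.complexConj L) 2).Adelic) * g)) ∂ν)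 * ((borelHeight g : ℝ) : ℂ) ^ (z - 1)) (k : (quasiSplit (↥(maximalRealSubfield L)) L (IsCMField.complexConj L) 2).Adelic) * conj (φ' (k : (quasiSplit (↥(maximalRealSubfield L)) L (IsCMField.complexConj L) 2).Adelic)) ∂μK)) ∂νI)
              - (((T : ℝ) : ℂ) ^ (-(z + conj z' - 1)) / (z + conj z' - 1)) * ((∫ x in {x : (AdeleRing (𝓞 L) L)ˣ | (IdeleClassGroup.ideleNorm L x : ℝ) ≤ 1} ∩ 𝓕I, ((IdeleClassGroup.ideleNorm L x : ℝ) : ℂ) ∂νI) *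
                  (∫ k, (fun g : (quasiSplit (↥(maximalRealSubfield L)) L (IsCMField.complexConj L) 2).Adelic => (∫ v : ↥(adelicUnipotent (↥(maximalRealSubfield L)) L (IsCMField.complexConj L) 2), flatSectionU φ z ((quasiSplit (↥(maximalRealSubfield L)) L (IsCMField.complexConj L) 2).toAdelic (weylLongU ((IsCMField.complexConj L : L ≃ₐ[↥(maximalRealSubfield L)] L) : L →+* L) (rfl : (StdForm.antidiagonal 2).over L = (StdForm.antidiagonal 2).over L)) * ((v : (quasiSplit (↥(maximalRealSubfield L)) L (IsCMField.complexConj L) 2).Adelic) * g)) ∂ν) * ((borelHeight g : ℝ) : ℂ) ^ (z - 1)) (k : (quasiSplit (↥(maximalRealSubfield L)) L (IsCMField.complexConj L) 2).Adelic) * conj ((fun g : (quasiSplit (↥(maximalRealSubfield L)) L (IsCMField.complexConj L) 2).Adelic => (∫ v : ↥(adelicUnipotent (↥(maximalRealSubfield L)) L (IsCMField.complexConj L) 2), flatSectionU φ' z' ((quasiSplit (↥(maximalRealSubfield L)) L (IsCMField.complexConj L) 2).toAdelic (weylLongU ((IsCMField.complexConj L : L ≃ₐ[↥(maximalRealSubfield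 L)] L) : L →+* L) (rfl : (StdForm.antidiagonal 2).over L = (StdForm.antidiagonal 2).over L)) * ((v : (quasiSplit (↥(maximalRealSubfield L)) L (IsCMField.complexConj L) 2).Adelic) * g)) ∂ν) * ((borelHeight g : ℝ) : ℂ) ^ (z' - 1)) (k : (quasiSplit (↥(maximalRealSubfield L)) L (IsCMField.complexConj L) 2).Adelic)) ∂μK)))) := by
  obtain ⟨cμ, K, hcμ, hK, h⟩ := maassSelberg_chiSection_cm_two L μ νG μK νI h𝓕I ν h𝓕N h𝓕1 h𝓕c
  refine ⟨cμ, K, hcμ, hK, ?_⟩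
  intro β hβ T hT χ hχ hρ φ φ' hφc hφ Cφ hφC hφ'c hφ' Cφ' hφ'C z z' hz' hzz' M₁ hdec'
  have key := h hβ hT hχ hρ hχ hρ hφc hφ hφC hφ'c hφ' hφ'C hz' hzz' hdec'
  have h1 : ∀ x : (AdeleRing (𝓞 L) L)ˣ, ((χ x : ℂˣ) : ℂ) * conj ((χ x : ℂˣ) : ℂ) = 1 := fun x => by
    rw [Complex.mul_conj, Complex.normSq_eq_norm_sq, hχ x, one_pow, Complex.ofReal_one]
  have h4 : ∀ x : (AdeleRing (𝓞 L) L)ˣ, ((reflectChar (IsCMField.complexConj L) χ x : ℂˣ) : ℂ) * conj ((reflectChar (IsCMField.complexConj L) χ x : ℂˣ) : ℂ) = 1 := fun x => by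
    rw [Complex.mul_conj, Complex.normSq_eq_norm_sq, IsUnitary.reflectChar hχ x, one_pow, Complex.ofReal_one]
  simp only [h1, h4, one_mul, integral_mul_const] at key
  exact key

end CM

end Summit.HodgeConjecture.HodgeConjecture.Cruxes.H413.K2E1ChiMaassSelbergCMTwo

end
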